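import Summits.AtomisticToContinuum.BoseEinsteinCondensation.Theorems.BECRieszReverseHolderCoarseRH2Toolkit
import HarnessLib

/-!
# Route `BECRieszReverseHolder`, crux `CoarseGrainedReverseHolder`
# (stmt-AtomisticToContinuum-12840), line `registered`: stub `stub_partitionComparison`

Supports (does not close) stmt-AtomisticToContinuum-12840; stub `stub_partitionComparison` of the
line `registered` (`Cruxes/CoarseGrainedReverseHolder/Lines/registered.lean`).

**Partition comparison (coarser ≤ 216 × finer).** For `0 < L`, `0 < M ≤ m`, any slice
`F : ℝ³ → ℂ` and any normalisation `D ∈ [0,∞]`, the cube functional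
`M³ Σ_K (∫_{Q_K} |F|²)² / D` over the `M³` congruent half-open cubes
`Q_K = ∏ᵢ [Kᵢ L/M, (Kᵢ+1) L/M)` of `[0,L)³` is at most `216` times the same functional over the
`m³` cubes of side `L/m`.

Proof (elementary; no measurability of `F` is needed).
* Cover: a coarse cube `Q_K` lies in `[0,L)³`, hence in the union of the fine cubes `q` it meets;
  per axis these are the `qᵢ` with `qᵢ M < (Kᵢ+1) m ∧ Kᵢ m < (qᵢ+1) M` (integer form of
  "the half-open intervals intersect"), so `∫_{Q_K} ≤ Σ_{q meets K} ∫_q` by subadditivity of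
  the restricted measures (`lintegral_iUnion_le`).
* Cauchy–Schwarz on the finite sum and counting: per axis at most `m/M + 2` fine indices meet a
  coarse one (they lie in `[Kᵢ m / M, Kᵢ m / M + m/M + 1]`, natural division) and at most `2`
  coarse indices meet a fine one; so `(∫_{Q_K})² ≤ (m/M+2)³ Σ_{q meets K} (∫_q)²` and, swapping
  the double sum, `Σ_K (∫_{Q_K})² ≤ 8 (m/M+2)³ Σ_q (∫_q)²` (abstract double counting,
  `sum_sq_le_of_cover`).
* Arithmetic: `M³ · 8 (m/M+2)³ = 8 (M (m/M) + 2M)³ ≤ 8 (3m)³ = 216 m³`; finally divide by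
  `D` (`ENNReal.div_le_div_right`, `mul_div_assoc`).

Mathlib + the cube API of `Literature.MathematicalPhysics.QuantumManyBody.BoseGas` (`subCell`,
`mem_subCell`, `subCell_subset_cell`, `exists_mem_subCell`) and
`CoarseRH2.setOf_forall_mem_Ico_eq_subCell` (identification of the cubes with `subCell (L/m)`).
No new definitions: the meeting relation is written out as `Finset.filter`/`Fintype.piFinset`.
-/

noncomputable section

open MeasureTheory
open scoped ENNReal NNReal BigOperators

namespace Summit.AtomisticToContinuum.BoseEinsteinCondensation.Theorems.CoarseGrainedReverseHolder

open Literature.MathematicalPhysics.QuantumManyBody BoseGas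

namespace PartitionComparison

/-! ### Generic tools: Cauchy–Schwarz, finite covers, abstract double counting -/

/-- Cauchy–Schwarz for a finite `ℝ≥0∞`-sum:
`(Σ_{i ∈ s} a_i)² ≤ #s · Σ_{i ∈ s} a_i²`. -/
theorem sq_sum_le_card_mul_sum_sq {ι : Type*} (s : Finset ι) (a : ι → ℝ≥0∞) :
    (∑ i ∈ s, a i) ^ 2 ≤ (s.card : ℝ≥0∞) * ∑ i ∈ s, a i ^ 2 := by
  have h := ENNReal.rpow_sum_le_const_mul_sum_rpow s a (p := 2) (by norm_num)
  norm_num at h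
  simpa [ENNReal.rpow_two] using h

/-- If `s` is covered by the finitely many sets `U q`, `q ∈ J`, then
`∫⁻_s f ≤ Σ_{q ∈ J} ∫⁻_{U q} f` (subadditivity of the restricted measures; no measurability of `s`,
`U q` or `f` is needed). -/
theorem setLIntegral_le_sum_of_subset {α κ : Type*} [MeasurableSpace α] {μ : Measure α}
    (J : Finset κ) {s : Set α} {U : κ → Set α} (h : s ⊆ ⋃ q ∈ J, U q) (f : α → ℝ≥0∞) :
    ∫⁻ a in s, f a ∂μ ≤ ∑ q ∈ J, ∫⁻ a in U q, f a ∂μ :=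
  calc ∫⁻ a in s, f a ∂μ ≤ ∫⁻ a in ⋃ q : J, U q, f a ∂μ := by
        refine lintegral_mono_set (h.trans fun x hx => ?_)
        obtain ⟨q, hq, hxq⟩ := Set.mem_iUnion₂.mp hx
        exact Set.mem_iUnion.mpr ⟨⟨q, hq⟩, hxq⟩
    _ ≤ ∑' q : J, ∫⁻ a in U q, f a ∂μ := lintegral_iUnion_le _ _
    _ = ∑ q ∈ J, ∫⁻ a in U q, f a ∂μ := Finset.tsum_subtype J fun q => ∫⁻ a in U q, f a ∂μ

/-- **Abstract double counting.** Let `J K ⊆ κ` (`K : ι`) and `I q ⊆ ι` (`q : κ`) encode one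
relation (`q ∈ J K ↔ K ∈ I q`) with `#J K ≤ c₁`, `#I q ≤ c₂`, and let `a K ≤ Σ_{q ∈ J K} b q`.
Then `Σ_K a_K² ≤ c₁ c₂ Σ_q b_q²` (Cauchy–Schwarz in each `J K`, then swap the double sum). -/
theorem sum_sq_le_of_cover {ι κ : Type*} [Fintype ι] [Fintype κ] (J : ι → Finset κ)
    (I : κ → Finset ι) (hIJ : ∀ K q, q ∈ J K ↔ K ∈ I q) {a : ι → ℝ≥0∞} {b : κ → ℝ≥0∞}
    {c₁ c₂ : ℕ} (hcover : ∀ K, a K ≤ ∑ q ∈ J K, b q) (h₁ : ∀ K, (J K).card ≤ c₁)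
    (h₂ : ∀ q, (I q).card ≤ c₂) :
    ∑ K, a K ^ 2 ≤ ((c₁ * c₂ : ℕ) : ℝ≥0∞) * ∑ q, b q ^ 2 := by
  have hK : ∀ K, a K ^ 2 ≤ (c₁ : ℝ≥0∞) * ∑ q ∈ J K, b q ^ 2 := fun K =>
    calc a K ^ 2 ≤ (∑ q ∈ J K, b q) ^ 2 := by
          gcongr
          exact hcover K
      _ ≤ ((J K).card : ℝ≥0∞) * ∑ q ∈ J K, b q ^ 2 := sq_sum_le_card_mul_sum_sq _ _
      _ ≤ (c₁ : ℝ≥0∞) * ∑ q ∈ J K, b q ^ 2 := mul_le_mul_left (by exact_mod_cast h₁ K) _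
  have hrel : ∀ (K : ι) (q : κ),
      K ∈ Finset.univ ∧ q ∈ J K ↔ K ∈ I q ∧ q ∈ Finset.univ := fun K q => by
    simp only [Finset.mem_univ, true_and, and_true, hIJ]
  have hswap : ∑ K, ∑ q ∈ J K, b q ^ 2 = ∑ q, ((I q).card : ℝ≥0∞) * b q ^ 2 := by
    rw [Finset.sum_comm' hrel]
    simp only [Finset.sum_const, nsmul_eq_mul]
  calc ∑ K, a K ^ 2 ≤ ∑ K, (c₁ : ℝ≥0∞) * ∑ q ∈ J K, b q ^ 2 :=
        Finset.sum_le_sum fun K _ => hK K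
    _ = (c₁ : ℝ≥0∞) * ∑ q, ((I q).card : ℝ≥0∞) * b q ^ 2 := by rw [← Finset.mul_sum, hswap]
    _ ≤ (c₁ : ℝ≥0∞) * ∑ q, (c₂ : ℝ≥0∞) * b q ^ 2 :=
        mul_le_mul_right (Finset.sum_le_sum fun q _ =>
          mul_le_mul_left (by exact_mod_cast h₂ q) _) _
    _ = ((c₁ * c₂ : ℕ) : ℝ≥0∞) * ∑ q, b q ^ 2 := by
        rw [← Finset.mul_sum, ← mul_assoc, Nat.cast_mul]

/-! ### Counting the meeting relation, per axis

The coarse interval `[K L/M, (K+1) L/M)` and the fine interval `[q L/m, (q+1) L/m)` intersect iff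
`q M < (K+1) m ∧ K m < (q+1) M` (multiply through by `m M / L`). -/

/-- At most `m / M + 2` fine indices meet a given coarse index `K`: they all lie in the integer
interval `[K m / M, K m / M + m / M + 1]` (natural division). -/
theorem card_filter_fine_le {M : ℕ} (hM : 0 < M) (m K : ℕ) :
    (Finset.univ.filter fun q : Fin m =>
        (q : ℕ) * M < (K + 1) * m ∧ K * m < ((q : ℕ) + 1) * M).card ≤ m / M + 2 := by
  set A := K * m / M with hA
  have hmaps : ∀ q ∈ (Finset.univ.filter fun q : Fin m =>
      (q : ℕ) * M < (K + 1) * m ∧ K * m < ((q : ℕ) + 1) * M),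
      (q : ℕ) ∈ Finset.Icc A (A + (m / M + 1)) := by
    intro q hq
    simp only [Finset.mem_filter, Finset.mem_univ, true_and] at hq
    obtain ⟨h1, h2⟩ := hq
    rw [Finset.mem_Icc]
    refine ⟨Nat.lt_succ_iff.mp ((Nat.div_lt_iff_lt_mul hM).mpr h2), ?_⟩
    have hKm : K * m < (A + 1) * M := by
      rw [hA, Nat.mul_comm (K * m / M + 1) M]
      exact Nat.lt_mul_div_succ (K * m) hM
    have hm : m < (m / M + 1) * M := by
      rw [Nat.mul_comm (m / M + 1) M]
      exact Nat.lt_mul_div_succ m hM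
    have h3 : (q : ℕ) * M < (A + (m / M + 1) + 1) * M :=
      calc (q : ℕ) * M < (K + 1) * m := h1
        _ = K * m + m := by ring
        _ < (A + 1) * M + (m / M + 1) * M := add_lt_add hKm hm
        _ = (A + (m / M + 1) + 1) * M := by ring
    exact Nat.lt_succ_iff.mp (Nat.lt_of_mul_lt_mul_right h3)
  calc _ ≤ (Finset.Icc A (A + (m / M + 1))).card :=
        Finset.card_le_card_of_injOn (fun q : Fin m => (q : ℕ)) hmaps
          fun q₁ _ q₂ _ h => Fin.ext h
    _ = m / M + 2 := by rw [Nat.card_Icc, add_assoc, Nat.add_sub_cancel_left]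

/-- At most `2` coarse indices meet a given fine index `q` when `M ≤ m` (a fine interval is not
longer than a coarse one): they lie in the integer interval `[q M / m, q M / m + 1]`. -/
theorem card_filter_coarse_le {M m : ℕ} (hM : 0 < M) (hMm : M ≤ m) (q : ℕ) :
    (Finset.univ.filter fun K : Fin M =>
        q * M < ((K : ℕ) + 1) * m ∧ (K : ℕ) * m < (q + 1) * M).card ≤ 2 := by
  have hm : 0 < m := lt_of_lt_of_le hM hMm
  set A := q * M / m with hA
  have hmaps : ∀ K ∈ (Finset.univ.filter fun K : Fin M =>
      q * M < ((K : ℕ) + 1) * m ∧ (K : ℕ) * m < (q + 1) * M),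
      (K : ℕ) ∈ Finset.Icc A (A + 1) := by
    intro K hK
    simp only [Finset.mem_filter, Finset.mem_univ, true_and] at hK
    obtain ⟨h1, h2⟩ := hK
    rw [Finset.mem_Icc]
    refine ⟨Nat.lt_succ_iff.mp ((Nat.div_lt_iff_lt_mul hm).mpr h1), ?_⟩
    have hqM : q * M < (A + 1) * m := by
      rw [hA, Nat.mul_comm (q * M / m + 1) m]
      exact Nat.lt_mul_div_succ (q * M) hm
    have h3 : (K : ℕ) * m < (A + 1 + 1) * m :=
      calc (K : ℕ) * m < (q + 1) * M := h2
        _ = q * M + M := by ring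
        _ < (A + 1) * m + m := add_lt_add_of_lt_of_le hqM hMm
        _ = (A + 1 + 1) * m := by ring
    exact Nat.lt_succ_iff.mp (Nat.lt_of_mul_lt_mul_right h3)
  calc _ ≤ (Finset.Icc A (A + 1)).card :=
        Finset.card_le_card_of_injOn (fun K : Fin M => (K : ℕ)) hmaps
          fun K₁ _ K₂ _ h => Fin.ext h
    _ = 2 := by rw [Nat.card_Icc, add_assoc, Nat.add_sub_cancel_left]

/-! ### The meeting relation between cubes: symmetry, counting, cover -/

/-- The fine cubes meeting a coarse cube `K` and the coarse cubes meeting a fine cube `q`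
(products over the three axes of the per-axis relation) encode one symmetric relation. -/
theorem mem_piFinset_fine_iff (M m : ℕ) (K : Fin 3 → Fin M) (q : Fin 3 → Fin m) :
    (q ∈ Fintype.piFinset fun i => Finset.univ.filter fun q : Fin m =>
        (q : ℕ) * M < ((K i : ℕ) + 1) * m ∧ (K i : ℕ) * m < ((q : ℕ) + 1) * M) ↔
      K ∈ Fintype.piFinset fun i => Finset.univ.filter fun K : Fin M =>
        (q i : ℕ) * M < ((K : ℕ) + 1) * m ∧ (K : ℕ) * m < ((q i : ℕ) + 1) * M := by
  simp only [Fintype.mem_piFinset, Finset.mem_filter, Finset.mem_univ, true_and]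

/-- At most `(m / M + 2)³` fine cubes meet a coarse cube. -/
theorem card_piFinset_fine_le {M : ℕ} (hM : 0 < M) (m : ℕ) (K : Fin 3 → Fin M) :
    (Fintype.piFinset fun i => Finset.univ.filter fun q : Fin m =>
        (q : ℕ) * M < ((K i : ℕ) + 1) * m ∧ (K i : ℕ) * m < ((q : ℕ) + 1) * M).card ≤
      (m / M + 2) ^ 3 := by
  rw [Fintype.card_piFinset]
  calc _ ≤ ∏ _i : Fin 3, (m / M + 2) :=
        Finset.prod_le_prod (fun i _ => Nat.zero_le _) fun i _ => card_filter_fine_le hM m _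
    _ = (m / M + 2) ^ 3 := by rw [Finset.prod_const, Finset.card_univ, Fintype.card_fin]

/-- At most `2³` coarse cubes meet a fine cube (`M ≤ m`). -/
theorem card_piFinset_coarse_le {M m : ℕ} (hM : 0 < M) (hMm : M ≤ m) (q : Fin 3 → Fin m) :
    (Fintype.piFinset fun i => Finset.univ.filter fun K : Fin M =>
        (q i : ℕ) * M < ((K : ℕ) + 1) * m ∧ (K : ℕ) * m < ((q i : ℕ) + 1) * M).card ≤ 2 ^ 3 := by
  rw [Fintype.card_piFinset]
  calc _ ≤ ∏ _i : Fin 3, 2 :=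
        Finset.prod_le_prod (fun i _ => Nat.zero_le _) fun i _ => card_filter_coarse_le hM hMm _
    _ = 2 ^ 3 := by rw [Finset.prod_const, Finset.card_univ, Fintype.card_fin]

/-- From the real inequality `L/m · a < L/M · b` (`0 < L`, `0 < M`, `0 < m`) to the integer one
`a M < b m`. -/
theorem mul_lt_mul_of_div_mul_lt {L : ℝ} (hL : 0 < L) {M m : ℕ} (hM : 0 < M) (hm : 0 < m)
    {a b : ℕ} (h : L / m * a < L / M * b) : a * M < b * m := by
  have hM' : (0 : ℝ) < M := Nat.cast_pos.2 hM
  have hm' : (0 : ℝ) < m := Nat.cast_pos.2 hm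
  rw [div_mul_eq_mul_div, div_mul_eq_mul_div, div_lt_div_iff₀ hm' hM', mul_assoc, mul_assoc] at h
  have h' : (a : ℝ) * M < (b : ℝ) * m := lt_of_mul_lt_mul_left h hL.le
  exact_mod_cast h'

/-- **Cover.** The coarse cube `subCell (L/M) K ⊆ [0,L)³` is contained in the union of the fine
cubes `subCell (L/m) q` meeting it: every point of `[0,L)³` lies in the fine cube
`qᵢ = ⌊yᵢ m / L⌋`, and that cube meets `K` on every axis. -/
theorem subCell_subset_biUnion {L : ℝ} (hL : 0 < L) {M m : ℕ} (hM : 0 < M) (hMm : M ≤ m)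
    (K : Fin 3 → Fin M) :
    subCell (L / M) K ⊆ ⋃ q ∈ (Fintype.piFinset fun i => Finset.univ.filter fun q : Fin m =>
        (q : ℕ) * M < ((K i : ℕ) + 1) * m ∧ (K i : ℕ) * m < ((q : ℕ) + 1) * M),
      subCell (L / m) q := by
  have hm : 0 < m := lt_of_lt_of_le hM hMm
  have hM' : (0 : ℝ) < M := Nat.cast_pos.2 hM
  have hm' : (0 : ℝ) < m := Nat.cast_pos.2 hm
  have hS : 0 < L / M := div_pos hL hM'
  have hs : 0 < L / m := div_pos hL hm'
  intro y hy
  have hy_cell : y ∈ cell ((m : ℝ) * (L / m)) := by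
    rw [mul_div_cancel₀ L hm'.ne', ← mul_div_cancel₀ L hM'.ne']
    exact subCell_subset_cell hS K hy
  obtain ⟨q, hq⟩ := exists_mem_subCell (k := m) hs hy_cell
  have hmem : q ∈ Fintype.piFinset fun i => Finset.univ.filter fun q : Fin m =>
      (q : ℕ) * M < ((K i : ℕ) + 1) * m ∧ (K i : ℕ) * m < ((q : ℕ) + 1) * M := by
    rw [Fintype.mem_piFinset]
    intro i
    simp only [Finset.mem_filter, Finset.mem_univ, true_and]
    rw [mem_subCell] at hy hq
    obtain ⟨hK1, hK2⟩ := hy i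
    obtain ⟨hq1, hq2⟩ := hq i
    constructor
    · refine mul_lt_mul_of_div_mul_lt hL hM hm ?_
      push_cast
      linarith
    · refine mul_lt_mul_of_div_mul_lt hL hm hM ?_
      push_cast
      linarith
  exact Set.mem_biUnion hmem hq

/-! ### The numerator inequality and the stub -/

/-- **Numerator comparison.** For every weight `w : ℝ³ → [0,∞]` (no measurability assumed),
`M³ Σ_K (∫_{subCell (L/M) K} w)² ≤ 216 · m³ Σ_q (∫_{subCell (L/m) q} w)²` whenever
`0 < M ≤ m`. -/
theorem numerator_le {L : ℝ} (hL : 0 < L) {M m : ℕ} (hM : 0 < M) (hMm : M ≤ m)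
    (w : Space → ℝ≥0∞) :
    (M : ℝ≥0∞) ^ 3 * ∑ K : Fin 3 → Fin M, (∫⁻ y in subCell (L / M) K, w y) ^ 2 ≤
      216 * ((m : ℝ≥0∞) ^ 3 *
        ∑ q : Fin 3 → Fin m, (∫⁻ y in subCell (L / m) q, w y) ^ 2) := by
  -- cover + Cauchy–Schwarz + double counting
  have hmain : ∑ K : Fin 3 → Fin M, (∫⁻ y in subCell (L / M) K, w y) ^ 2 ≤
      (((m / M + 2) ^ 3 * 2 ^ 3 : ℕ) : ℝ≥0∞) *
        ∑ q : Fin 3 → Fin m, (∫⁻ y in subCell (L / m) q, w y) ^ 2 :=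
    sum_sq_le_of_cover
      (fun K : Fin 3 → Fin M => Fintype.piFinset fun i => Finset.univ.filter fun q : Fin m =>
        (q : ℕ) * M < ((K i : ℕ) + 1) * m ∧ (K i : ℕ) * m < ((q : ℕ) + 1) * M)
      (fun q : Fin 3 → Fin m => Fintype.piFinset fun i => Finset.univ.filter fun K : Fin M =>
        (q i : ℕ) * M < ((K : ℕ) + 1) * m ∧ (K : ℕ) * m < ((q i : ℕ) + 1) * M)
      (mem_piFinset_fine_iff M m)
      (fun K => setLIntegral_le_sum_of_subset _ (subCell_subset_biUnion hL hM hMm K) w)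
      (card_piFinset_fine_le hM m) (card_piFinset_coarse_le hM hMm)
  -- the arithmetic of the constants, in `ℕ`
  have hnat : M ^ 3 * ((m / M + 2) ^ 3 * 2 ^ 3) ≤ 216 * m ^ 3 := by
    have h1 : M * (m / M + 2) ≤ 3 * m :=
      calc M * (m / M + 2) = M * (m / M) + 2 * M := by ring
        _ ≤ m + 2 * m := add_le_add (Nat.mul_div_le m M) (by omega)
        _ = 3 * m := by ring
    calc M ^ 3 * ((m / M + 2) ^ 3 * 2 ^ 3) = (M * (m / M + 2)) ^ 3 * 8 := by ring
      _ ≤ (3 * m) ^ 3 * 8 := by gcongr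
      _ = 216 * m ^ 3 := by ring
  calc (M : ℝ≥0∞) ^ 3 * ∑ K : Fin 3 → Fin M, (∫⁻ y in subCell (L / M) K, w y) ^ 2
      ≤ (M : ℝ≥0∞) ^ 3 * ((((m / M + 2) ^ 3 * 2 ^ 3 : ℕ) : ℝ≥0∞) *
          ∑ q : Fin 3 → Fin m, (∫⁻ y in subCell (L / m) q, w y) ^ 2) :=
        mul_le_mul_right hmain _
    _ = ((M ^ 3 * ((m / M + 2) ^ 3 * 2 ^ 3) : ℕ) : ℝ≥0∞) *
          ∑ q : Fin 3 → Fin m, (∫⁻ y in subCell (L / m) q, w y) ^ 2 := by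
        push_cast
        ring
    _ ≤ ((216 * m ^ 3 : ℕ) : ℝ≥0∞) *
          ∑ q : Fin 3 → Fin m, (∫⁻ y in subCell (L / m) q, w y) ^ 2 :=
        mul_le_mul_left (by exact_mod_cast hnat) _
    _ = 216 * ((m : ℝ≥0∞) ^ 3 *
          ∑ q : Fin 3 → Fin m, (∫⁻ y in subCell (L / m) q, w y) ^ 2) := by
        push_cast
        ring

end PartitionComparison

open PartitionComparison in
/-- **Partition comparison (coarser ≤ 216 × finer).** For `0 < L`, `0 < M ≤ m`, any slice
`F : ℝ³ → ℂ` and any normalisation `D ∈ [0,∞]`: the cube functional over the `M³` congruent cubes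
of side `L/M` is at most `216` times the one over the `m³` cubes of side `L/m`. Proof: every
coarse cube `K = ∏ [Kᵢ L/M, (Kᵢ+1) L/M)` is covered by the fine cubes meeting it — at most
`m/M + 2` of them per axis — so `(∫_K |F|²)² ≤ (m/M+2)³ Σ_{q meets K} (∫_q |F|²)²`
(Cauchy–Schwarz), while a fine cube meets at most `2` coarse cubes per axis (`L/m ≤ L/M`);
summing, `M³ Σ_K (∫_K|F|²)² ≤ 8 (M (m/M) + 2M)³ Σ_q (∫_q|F|²)² ≤ 216 m³ Σ_q (∫_q|F|²)²`, and
division by `D` is monotone (`ℝ≥0∞` conventions included). -/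
theorem stub_partitionComparison {L : ℝ} (hL : 0 < L) {M m : ℕ} (hM : 0 < M) (hMm : M ≤ m)
    (F : EuclideanSpace ℝ (Fin 3) → ℂ) (D : ℝ≥0∞) :
    (M : ℝ≥0∞) ^ 3 * ((∑ K : Fin 3 → Fin M,
        (∫⁻ y in {y : EuclideanSpace ℝ (Fin 3) | ∀ i, y i ∈
            Set.Ico ((K i : ℝ) * (L / M)) (((K i : ℝ) + 1) * (L / M))},
          (‖F y‖₊ : ℝ≥0∞) ^ 2) ^ 2) / D) ≤
      216 * ((m : ℝ≥0∞) ^ 3 * ((∑ k : Fin 3 → Fin m,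
        (∫⁻ y in {y : EuclideanSpace ℝ (Fin 3) | ∀ i, y i ∈
            Set.Ico ((k i : ℝ) * (L / m)) (((k i : ℝ) + 1) * (L / m))},
          (‖F y‖₊ : ℝ≥0∞) ^ 2) ^ 2) / D)) := by
  simp only [CoarseRH2.setOf_forall_mem_Ico_eq_subCell]
  simpa only [mul_div_assoc] using
    ENNReal.div_le_div_right (numerator_le hL hM hMm fun y => (‖F y‖₊ : ℝ≥0∞) ^ 2) D

end Summit.AtomisticToContinuum.BoseEinsteinCondensation.Theorems.CoarseGrainedReverseHolder
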